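import Summits.Ventures.PercRepro.C041TriangleSquare
import Summits.Ventures.PercRepro.C041TriangleLeafStar3

/-!
# THE K₃⁺-TRANSFER OF THE LEAF MAP (mine-3, gen 67; C-041.md §21 (bg))

With THEOREM (LEAF × THREE-LEAF STAR) `InCone_thetaTri_leafStar3` in the kernel, bilinearity carries the leaf map
`w′ ↦ θ_△(v c, w′)` over the explicit cone `K₃⁺ = cone{1, v s, v s * v t, v s * v t * v u, X(p,q)}`
(`InCone_thetaTri_leaf_K3plus`): every star with such a decomposition is settled against a leaf
(`InCone_thetaTri_leaf_of_K3plus`).  The gen-67 census: about two thirds of the random four- to eight-leaf stars lie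
in `K₂⁺` already (inner approximation), so the transfer reaches most larger stars, not all.
-/

namespace PercRepro

namespace RelaxedTriangle

open TreeClosure Finset

/-- A product of three leaves at atoms in `[0, 1]` is a cone element. -/
theorem InCone_v_mul_v_mul_v {s t u : ℝ} (hs : 0 ≤ s ∧ s ≤ 1) (ht : 0 ≤ t ∧ t ≤ 1) (hu : 0 ≤ u ∧ u ≤ 1) :
    InCone (v s * v t * v u) := ((InCone_v s hs).mul (InCone_v t ht)).mul (InCone_v u hu)

/-- **THE K₃⁺-TRANSFER OF THE LEAF MAP**: `θ_△(v c, w′) ∈ cone` for every `w′` in the explicit cone generated by `1`,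
the leaves, the two- and three-leaf products and the marked vertices. -/
theorem InCone_thetaTri_leaf_K3plus (c : ℝ) (hc : 0 ≤ c ∧ c ≤ 1) {n₁ n₂ n₃ n₄ : ℕ}
    (l0 : ℝ) (hl0 : 0 ≤ l0)
    (μ s : Fin n₁ → ℝ) (hμ : ∀ i, 0 ≤ μ i) (hs : ∀ i, 0 ≤ s i ∧ s i ≤ 1)
    (ρ s' t' : Fin n₂ → ℝ) (hρ : ∀ j, 0 ≤ ρ j) (hs' : ∀ j, 0 ≤ s' j ∧ s' j ≤ 1) (ht' : ∀ j, 0 ≤ t' j ∧ t' j ≤ 1)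
    (κ s'' t'' u'' : Fin n₃ → ℝ) (hκ : ∀ k, 0 ≤ κ k) (hs'' : ∀ k, 0 ≤ s'' k ∧ s'' k ≤ 1)
    (ht'' : ∀ k, 0 ≤ t'' k ∧ t'' k ≤ 1) (hu'' : ∀ k, 0 ≤ u'' k ∧ u'' k ≤ 1)
    (ν : Fin n₄ → ℝ) (p q : Fin n₄ → ℕ) (hν : ∀ l, 0 ≤ ν l) :
    InCone (thetaTri (v c) (l0 • (1 : Vec6) + ∑ i, μ i • v (s i) + ∑ j, ρ j • (v (s' j) * v (t' j))
      + ∑ k, κ k • (v (s'' k) * v (t'' k) * v (u'' k)) + ∑ l, ν l • (v 1 ^ p l * v 0 ^ q l))) := by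
  have hvc : InCone (v c) := InCone_v c hc
  rw [thetaTri_add_right, thetaTri_add_right, thetaTri_add_right, thetaTri_add_right, thetaTri_sum_right,
    thetaTri_sum_right, thetaTri_sum_right, thetaTri_sum_right, thetaTri_smul_right]
  refine ((((InCone.smul _ hl0 ?_).add ?_).add ?_).add ?_).add ?_
  · have := InCone_thetaTri_any_marks' 0 0 hvc
    simpa using this
  · refine InCone_sum fun i => ?_
    rw [thetaTri_smul_right]
    exact (thetaTri_v_InCone c (s i) hc (hs i)).smul _ (hμ i)
  · refine InCone_sum fun j => ?_
    rw [thetaTri_smul_right]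
    exact (InCone_thetaTri_leaf_star2 (s' j) (t' j) c (hs' j) (ht' j) hc).smul _ (hρ j)
  · refine InCone_sum fun k => ?_
    rw [thetaTri_smul_right]
    exact (InCone_thetaTri_leafStar3 (s'' k) (t'' k) (u'' k) c (hs'' k) (ht'' k) (hu'' k) hc).smul _ (hκ k)
  · refine InCone_sum fun l => ?_
    rw [thetaTri_smul_right]
    exact (InCone_thetaTri_any_marks' (p l) (q l) hvc).smul _ (hν l)

/-- `H` at a leaf against a star with a `K₃⁺`-decomposition. -/
theorem InCone_thetaTri_leaf_of_K3plus (c : ℝ) (hc : 0 ≤ c ∧ c ≤ 1) {m : ℕ} (b : Fin m → ℝ) {n₁ n₂ n₃ n₄ : ℕ}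
    (l0 : ℝ) (hl0 : 0 ≤ l0)
    (μ s : Fin n₁ → ℝ) (hμ : ∀ i, 0 ≤ μ i) (hs : ∀ i, 0 ≤ s i ∧ s i ≤ 1)
    (ρ s' t' : Fin n₂ → ℝ) (hρ : ∀ j, 0 ≤ ρ j) (hs' : ∀ j, 0 ≤ s' j ∧ s' j ≤ 1) (ht' : ∀ j, 0 ≤ t' j ∧ t' j ≤ 1)
    (κ s'' t'' u'' : Fin n₃ → ℝ) (hκ : ∀ k, 0 ≤ κ k) (hs'' : ∀ k, 0 ≤ s'' k ∧ s'' k ≤ 1)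
    (ht'' : ∀ k, 0 ≤ t'' k ∧ t'' k ≤ 1) (hu'' : ∀ k, 0 ≤ u'' k ∧ u'' k ≤ 1)
    (ν : Fin n₄ → ℝ) (p q : Fin n₄ → ℕ) (hν : ∀ l, 0 ≤ ν l)
    (hb : V b = l0 • (1 : Vec6) + ∑ i, μ i • v (s i) + ∑ j, ρ j • (v (s' j) * v (t' j))
      + ∑ k, κ k • (v (s'' k) * v (t'' k) * v (u'' k)) + ∑ l, ν l • (v 1 ^ p l * v 0 ^ q l)) :
    InCone (thetaTri (v c) (V b)) := by
  rw [hb]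
  exact InCone_thetaTri_leaf_K3plus c hc l0 hl0 μ s hμ hs ρ s' t' hρ hs' ht' κ s'' t'' u'' hκ hs'' ht'' hu'' ν p q hν

end RelaxedTriangle

end PercRepro
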